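import Summits.QuantumFields.YangMills.Theorems.UnitScaleTiltHalvingSmallMembersCoverLift
import Literature.MathematicalPhysics.QuantumFieldTheory.Balaban1983to89.B9Eq310Hermitian
import Literature.MathematicalPhysics.QuantumFieldTheory.Balaban1983to89.B9TorusCalculus
import Literature.MathematicalPhysics.QuantumFieldTheory.Balaban1983to89.T3SectALandauChart
import HarnessLib

/-!
# Route `UnitScaleTilt`, crux K1 «MinimiserStabilityRegPr» (stmt-QuantumFields-19200), route-R E′ (N06) LANE II (★★OWNER RULING №23), brick (C5-a) «LIFT TO A COVER»
# (★p1 g19 NAMER WORD №1∕№3 «(C5-a) := px12 g7 — GO»), FILE F2a of px12 g7's LOCATE `LOCATE-C5a-COVERLIFT-px12g7.md` §2: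
# **THE LATTICE STENCILS OF [Balaban1985BackgroundPropagators] §3 ARE NATURAL UNDER A LATTICE MAP THAT INTERTWINES THE SHIFTS** — in particular under the covering map
# `proj` of the `L^{jc}`-fold cover (✓`CoverSites`): `D_μ`, `D*_μ`, the curl, `U(∂p)`, `D*`, the plaquette adjoint, the letter divergence, `z(p)`, `y(p)`, the Jordan and commutator letter
# functions, `Δ′` and `Δ = D*D + Δ′` ((3.3)–(3.10)), and the torus-letter stencils `covDerivFwdT ∕ covGradT ∕ covCurlT ∕ covCodiffT ∕ covCodiffCurlT ∕ covDivFormT`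

Cell `ym3-torus` (HUMAN RULING D-0037, YM ladder rung R3 — YM₃ on T³ is a rung, NOT d = 4, NOT infinite volume, NOT a mass gap, NOT Clay; YM gap NOT proved), width seat
`ym3-torus-px12` (gen 7).  THEOREMS ONLY (0 `def`, 0 `sorry`); `--supports stmt-QuantumFields-19200 --as helper`; count-neutral.  Pure bookkeeping (unfold + rewrite); nothing of
(V3)∕`hN06`∕the crux is claimed.

WHY.  (C5-a) transfers lane II's divergence-recovery row (✓`Prop7HcoOfDivRecovery.hCo_of_divRecovery`'s `hRec`) from the cover member `F.cover jc` to a small member term by term.  The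
member's Hilbert letters `DstarL2`, `DL2`, `covLapSite`, `DeltaEtaSlot` are READ on the route carriers through exactly these stencils (✓`Prop7DivSliceOfMemberDivSq.DstarL2_toL2_eq_toL2S`:
`divB (torusT …)`; ✓`Prop7SectET3DeltaEtaExplicit`∕✓`Prop7DeltaEtaAlmostPositive.symm_DeltaEta_toL2_apply`: `covCodiffCurlT 1 … + deltaPrimeOp (torusT …) …`), so their naturality under
the pullback along `proj` (file F2b) reduces to the pointwise identities below.  §1 is generic: ANY map `φ : S′ → S` with `φ ∘ T′_μ = T_μ ∘ φ` and `φ ∘ T′_μ⁻¹ = T_μ⁻¹ ∘ φ`, transporters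
and fields pulled back along `φ`.  §2 instantiates at `φ := proj P jc j`, `T := torusT` (✓`CoverSites.proj_shift`∕`proj_unshift`) and adds the torus-letter stencils (✓`covDerivT_comp_proj`
of ✓`…HalvingSmallMembersCoverLift` is the template and is reused).

References: T. Bałaban, CMP 99 (1985) 389–434 [Balaban1985BackgroundPropagators] ((3.1)–(3.10) pp.390–392); CMP 96 (1984) 223–250 [Balaban1984PropagatorsII] ((2.15)–(2.19) pp.225–226 —
operators on a covering torus).
-/

noncomputable section

open scoped BigOperators

namespace Summit.QuantumFields.YangMills.Theorems.Prop7CoverStencilNaturality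

open Literature.MathematicalPhysics.QuantumFieldTheory.Balaban1983to89
open B9Eq39Adjoint (R covD covDstar curl plaqU divB divP curlη divPη)
open B9Eq310Hermitian (divL zP yP jordanF sgnSum₁ sgnSum₂ sgnSum₃ sgnSum₄ commG₁ commG₂ commG₃ commG₄ deltaPrimeOp deltaOp)
open B9TorusCalculus (torusT torusT_apply torusT_symm_apply)
open B10Eq68TorusRegularity (plaqFT covDerivT covDivT)
open T3SectALandauChart (covDerivFwdT formComp covGradT covCurlT covCodiffT covCodiffCurlT covDivFormT covLapFormT)
open B7Eq78Linearization (conjR)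
open CoverSites
open Summit.QuantumFields.YangMills.Theorems.SmallMembersCoverLift (covDerivT_comp_proj)

/-! ## §1 Generic: a lattice map intertwining the shift data -/

section Generic

variable {𝔸 : Type*} [Ring 𝔸] {S S' : Type*} {ι : Type*}
  (T : ι → Equiv.Perm S) (T' : ι → Equiv.Perm S') (φ : S' → S) (U : ι → S → 𝔸ˣ)
  (hT : ∀ (μ : ι) (x : S'), φ (T' μ x) = T μ (φ x)) (hTs : ∀ (μ : ι) (x : S'), φ ((T' μ).symm x) = (T μ).symm (φ x))

include hT in
/-- `D_μ` (3.3) is natural: `(D_{U∘φ,μ}(f ∘ φ))(x′) = (D_{U,μ}f)(φ x′)`. [cite: Balaban1985BackgroundPropagators, (3.3) p.390] -/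
theorem covD_comp (μ : ι) (f : S → 𝔸) (x : S') :
    covD T' (fun κ y => U κ (φ y)) μ (fun y => f (φ y)) x = covD T U μ f (φ x) := by
  simp only [covD, hT]

include hTs in
/-- `D*_μ` (3.8) is natural. [cite: Balaban1985BackgroundPropagators, (3.8) p.392] -/
theorem covDstar_comp (μ : ι) (G : S → 𝔸) (x : S') :
    covDstar T' (fun κ y => U κ (φ y)) μ (fun y => G (φ y)) x = covDstar T U μ G (φ x) := by
  simp only [covDstar, hTs]

include hT in
/-- The curl (3.4) is natural. [cite: Balaban1985BackgroundPropagators, (3.4) p.391] -/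
theorem curl_comp (A : ι → S → 𝔸) (μ ν : ι) (x : S') :
    curl T' (fun κ y => U κ (φ y)) (fun κ y => A κ (φ y)) μ ν x = curl T U A μ ν (φ x) := by
  simp only [curl, covD, hT]

include hT in
/-- The plaquette variable `U(∂p)` is natural. [cite: Balaban1985BackgroundPropagators, (3.1) p.390] -/
theorem plaqU_comp (μ ν : ι) (x : S') :
    plaqU T' (fun κ y => U κ (φ y)) μ ν x = plaqU T U μ ν (φ x) := by
  simp only [plaqU, hT]

include hTs in
/-- The site divergence `D*` (3.8) is natural. [cite: Balaban1985BackgroundPropagators, (3.8) p.392] -/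
theorem divB_comp [Fintype ι] (A : ι → S → 𝔸) (x : S') :
    divB T' (fun κ y => U κ (φ y)) (fun κ y => A κ (φ y)) x = divB T U A (φ x) := by
  simp only [divB, covDstar, hTs]

include hTs in
/-- The plaquette adjoint (3.9) is natural. [cite: Balaban1985BackgroundPropagators, (3.9) p.392] -/
theorem divP_comp [Fintype ι] [LinearOrder ι] (Fp : ι → ι → S → 𝔸) (μ : ι) (x : S') :
    divP T' (fun κ y => U κ (φ y)) (fun κ κ' y => Fp κ κ' (φ y)) μ x = divP T U Fp μ (φ x) := by
  simp only [divP, covDstar, hTs]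

include hTs in
/-- The letter divergence `÷(G₁,G₂,G₃,G₄)` is natural. [cite: Balaban1985BackgroundPropagators, (3.9)-(3.10) p.392] -/
theorem divL_comp [Fintype ι] [LinearOrder ι] (G₁ G₂ G₃ G₄ : ι → ι → S → 𝔸) (μ : ι) (x : S') :
    divL T' (fun κ y => U κ (φ y)) (fun κ κ' y => G₁ κ κ' (φ y)) (fun κ κ' y => G₂ κ κ' (φ y)) (fun κ κ' y => G₃ κ κ' (φ y))
        (fun κ κ' y => G₄ κ κ' (φ y)) μ x = divL T U G₁ G₂ G₃ G₄ μ (φ x) := by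
  simp only [divL, hTs]

variable [Algebra ℂ 𝔸]

include hT in
/-- `z(p) = η⁻²(Re U(∂p) − 1)` is natural. [cite: Balaban1985BackgroundPropagators, (3.10) p.392] -/
theorem zP_comp (η : ℝ) (μ ν : ι) (x : S') :
    zP T' (fun κ y => U κ (φ y)) η μ ν x = zP T U η μ ν (φ x) := by
  simp only [zP, plaqU, hT]

include hT in
/-- `y(p) = η⁻² Im U(∂p)` is natural. [cite: Balaban1985BackgroundPropagators, (3.10) p.392] -/
theorem yP_comp (η : ℝ) (μ ν : ι) (x : S') :
    yP T' (fun κ y => U κ (φ y)) η μ ν x = yP T U η μ ν (φ x) := by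
  simp only [yP, plaqU, hT]

include hT in
/-- The Jordan-symmetrised first term `F^J_A` is natural. [cite: Balaban1985BackgroundPropagators, (3.10) p.392] -/
theorem jordanF_comp (η : ℝ) (A : ι → S → 𝔸) (μ ν : ι) (x : S') :
    jordanF T' (fun κ y => U κ (φ y)) η (fun κ y => A κ (φ y)) μ ν x = jordanF T U η A μ ν (φ x) := by
  simp only [jordanF, zP, curl, covD, plaqU, hT]

omit [Algebra ℂ 𝔸] in
include hT in
/-- The signed partner sums `S₁…S₄` are natural. [cite: Balaban1985BackgroundPropagators, (3.10) p.392] -/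
theorem sgnSum_comp (A : ι → S → 𝔸) (μ ν : ι) (x : S') :
    sgnSum₁ T' (fun κ y => U κ (φ y)) (fun κ y => A κ (φ y)) μ ν x = sgnSum₁ T U A μ ν (φ x) ∧
      sgnSum₂ T' (fun κ y => U κ (φ y)) (fun κ y => A κ (φ y)) μ ν x = sgnSum₂ T U A μ ν (φ x) ∧
      sgnSum₃ T' (fun κ y => U κ (φ y)) (fun κ y => A κ (φ y)) μ ν x = sgnSum₃ T U A μ ν (φ x) ∧
      sgnSum₄ T' (fun κ y => U κ (φ y)) (fun κ y => A κ (φ y)) μ ν x = sgnSum₄ T U A μ ν (φ x) := by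
  simp only [sgnSum₁, sgnSum₂, sgnSum₃, sgnSum₄, hT, and_self]

include hT in
/-- The commutator letter functions `G₁…G₄` are natural. [cite: Balaban1985BackgroundPropagators, (3.10) p.392] -/
theorem commG_comp (η : ℝ) (A : ι → S → 𝔸) (μ ν : ι) (x : S') :
    commG₁ T' (fun κ y => U κ (φ y)) η (fun κ y => A κ (φ y)) μ ν x = commG₁ T U η A μ ν (φ x) ∧
      commG₂ T' (fun κ y => U κ (φ y)) η (fun κ y => A κ (φ y)) μ ν x = commG₂ T U η A μ ν (φ x) ∧
      commG₃ T' (fun κ y => U κ (φ y)) η (fun κ y => A κ (φ y)) μ ν x = commG₃ T U η A μ ν (φ x) ∧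
      commG₄ T' (fun κ y => U κ (φ y)) η (fun κ y => A κ (φ y)) μ ν x = commG₄ T U η A μ ν (φ x) := by
  simp only [commG₁, commG₂, commG₃, commG₄, yP, plaqU, sgnSum₁, sgnSum₂, sgnSum₃, sgnSum₄, hT, and_self]

include hT in
/-- `D^η_U` (the `η`-scaled curl) is natural. [cite: Balaban1985BackgroundPropagators, (3.4) p.391] -/
theorem curlη_comp (η : ℝ) (A : ι → S → 𝔸) (μ ν : ι) (x : S') :
    curlη T' (fun κ y => U κ (φ y)) η (fun κ y => A κ (φ y)) μ ν x = curlη T U η A μ ν (φ x) := by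
  simp only [curlη, curl, covD, hT]

include hTs in
/-- `D^{η*}` (the `η`-scaled plaquette adjoint) is natural. [cite: Balaban1985BackgroundPropagators, (3.9) p.392] -/
theorem divPη_comp [Fintype ι] [LinearOrder ι] (η : ℝ) (Fp : ι → ι → S → 𝔸) (μ : ι) (x : S') :
    divPη T' (fun κ y => U κ (φ y)) η (fun κ κ' y => Fp κ κ' (φ y)) μ x = divPη T U η Fp μ (φ x) := by
  simp only [divPη, divP, covDstar, hTs]

include hT hTs in
/-- ★ **`Δ′` (3.10) IS NATURAL.** [cite: Balaban1985BackgroundPropagators, (3.10) p.392] -/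
theorem deltaPrimeOp_comp [Fintype ι] [LinearOrder ι] (η : ℝ) (A : ι → S → 𝔸) (μ : ι) (x : S') :
    deltaPrimeOp T' (fun κ y => U κ (φ y)) η (fun κ y => A κ (φ y)) μ x = deltaPrimeOp T U η A μ (φ x) := by
  have hJ : jordanF T' (fun κ y => U κ (φ y)) η (fun κ y => A κ (φ y)) = fun κ κ' y => jordanF T U η A κ κ' (φ y) := by
    funext κ κ' y; exact jordanF_comp T T' φ U hT η A κ κ' y
  have hG₁ : commG₁ T' (fun κ y => U κ (φ y)) η (fun κ y => A κ (φ y)) = fun κ κ' y => commG₁ T U η A κ κ' (φ y) := by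
    funext κ κ' y; exact (commG_comp T T' φ U hT η A κ κ' y).1
  have hG₂ : commG₂ T' (fun κ y => U κ (φ y)) η (fun κ y => A κ (φ y)) = fun κ κ' y => commG₂ T U η A κ κ' (φ y) := by
    funext κ κ' y; exact (commG_comp T T' φ U hT η A κ κ' y).2.1
  have hG₃ : commG₃ T' (fun κ y => U κ (φ y)) η (fun κ y => A κ (φ y)) = fun κ κ' y => commG₃ T U η A κ κ' (φ y) := by
    funext κ κ' y; exact (commG_comp T T' φ U hT η A κ κ' y).2.2.1
  have hG₄ : commG₄ T' (fun κ y => U κ (φ y)) η (fun κ y => A κ (φ y)) = fun κ κ' y => commG₄ T U η A κ κ' (φ y) := by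
    funext κ κ' y; exact (commG_comp T T' φ U hT η A κ κ' y).2.2.2
  rw [deltaPrimeOp, deltaPrimeOp, hJ, hG₁, hG₂, hG₃, hG₄, divP_comp T T' φ U hTs, divL_comp T T' φ U hTs]

include hT hTs in
/-- ★ **`Δ = D^{η*}D^η_U + Δ′` (3.10) IS NATURAL.** [cite: Balaban1985BackgroundPropagators, (3.10) p.392] -/
theorem deltaOp_comp [Fintype ι] [LinearOrder ι] (η : ℝ) (A : ι → S → 𝔸) (μ : ι) (x : S') :
    deltaOp T' (fun κ y => U κ (φ y)) η (fun κ y => A κ (φ y)) μ x = deltaOp T U η A μ (φ x) := by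
  have hC : curlη T' (fun κ y => U κ (φ y)) η (fun κ y => A κ (φ y)) = fun κ κ' y => curlη T U η A κ κ' (φ y) := by
    funext κ κ' y; exact curlη_comp T T' φ U hT η A κ κ' y
  rw [deltaOp, deltaOp, hC, divPη_comp T T' φ U hTs, deltaPrimeOp_comp T T' φ U hT hTs]

end Generic

/-! ## §2 The covering map `proj` of the `L^{jc}`-fold cover: the torus letters -/

section Torus

variable (P : Params) (jc : ℕ) {j : ℕ}

/-- `proj` intertwines the shifts `torusT`. [cite: Balaban1987RG1, (0.1) p.251] -/
theorem proj_torusT (μ : Fin P.d) (x : Site (cover P jc) j) : proj P jc j (torusT (cover P jc) j μ x) = torusT P j μ (proj P jc j x) := by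
  rw [torusT_apply, torusT_apply, proj_shift]

/-- `proj` intertwines the inverse shifts. [cite: Balaban1987RG1, (0.1) p.251] -/
theorem proj_torusT_symm (μ : Fin P.d) (x : Site (cover P jc) j) :
    proj P jc j ((torusT (cover P jc) j μ).symm x) = (torusT P j μ).symm (proj P jc j x) := by
  rw [torusT_symm_apply, torusT_symm_apply, proj_unshift]

variable {𝔸 : Type*} [Ring 𝔸]

/-- ★ `D*` in the `divB (torusT …)` letter of ✓`DstarL2_toL2_eq_toL2S` is natural under `proj`. [cite: Balaban1985BackgroundPropagators, (3.8) p.392] -/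
theorem divB_torusT_comp_proj (U : Fin P.d → Site P j → 𝔸ˣ) (A : Fin P.d → Site P j → 𝔸) (x : Site (cover P jc) j) :
    divB (torusT (cover P jc) j) (fun κ y => U κ (proj P jc j y)) (fun κ y => A κ (proj P jc j y)) x = divB (torusT P j) U A (proj P jc j x) :=
  divB_comp (torusT P j) (torusT (cover P jc) j) (proj P jc j) U (proj_torusT_symm P jc) A x

/-- ★ The curl in the `torusT` letter is natural under `proj`. [cite: Balaban1985BackgroundPropagators, (3.4) p.391] -/
theorem curl_torusT_comp_proj (U : Fin P.d → Site P j → 𝔸ˣ) (A : Fin P.d → Site P j → 𝔸) (μ ν : Fin P.d) (x : Site (cover P jc) j) :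
    curl (torusT (cover P jc) j) (fun κ y => U κ (proj P jc j y)) (fun κ y => A κ (proj P jc j y)) μ ν x = curl (torusT P j) U A μ ν (proj P jc j x) :=
  curl_comp (torusT P j) (torusT (cover P jc) j) (proj P jc j) U (proj_torusT P jc) A μ ν x

/-- ★ `Δ′` in the `torusT` letter of ✓`symm_DeltaEta_toL2_apply` is natural under `proj`. [cite: Balaban1985BackgroundPropagators, (3.10) p.392] -/
theorem deltaPrimeOp_torusT_comp_proj [Algebra ℂ 𝔸] (U : Fin P.d → Site P j → 𝔸ˣ) (η : ℝ) (A : Fin P.d → Site P j → 𝔸) (μ : Fin P.d)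
    (x : Site (cover P jc) j) :
    deltaPrimeOp (torusT (cover P jc) j) (fun κ y => U κ (proj P jc j y)) η (fun κ y => A κ (proj P jc j y)) μ x
      = deltaPrimeOp (torusT P j) U η A μ (proj P jc j x) :=
  deltaPrimeOp_comp (torusT P j) (torusT (cover P jc) j) (proj P jc j) U (proj_torusT P jc) (proj_torusT_symm P jc) η A μ x

/-- ★ `Δ^η` in the `torusT` letter of ✓`DeltaEta_toL2_eq` is natural under `proj`. [cite: Balaban1985BackgroundPropagators, (3.10) p.392] -/
theorem deltaOp_torusT_comp_proj [Algebra ℂ 𝔸] (U : Fin P.d → Site P j → 𝔸ˣ) (η : ℝ) (A : Fin P.d → Site P j → 𝔸) (μ : Fin P.d)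
    (x : Site (cover P jc) j) :
    deltaOp (torusT (cover P jc) j) (fun κ y => U κ (proj P jc j y)) η (fun κ y => A κ (proj P jc j y)) μ x
      = deltaOp (torusT P j) U η A μ (proj P jc j x) :=
  deltaOp_comp (torusT P j) (torusT (cover P jc) j) (proj P jc j) U (proj_torusT P jc) (proj_torusT_symm P jc) η A μ x

end Torus

/-! ## §3 The covering map `proj`: the one-form stencils of `T3SectALandauChart` (normed algebra letters) -/

section TorusForms

variable (P : Params) (jc : ℕ) {j : ℕ} {𝔸 : Type*} [NormedRing 𝔸] [NormedAlgebra ℂ 𝔸]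

omit [NormedRing 𝔸] [NormedAlgebra ℂ 𝔸] in
/-- `formComp` of a lifted one-form is the lift of `formComp`. [cite: Balaban1985Variational, (19) p.281] -/
theorem formComp_comp_projBond (X : PBond P j → 𝔸) (ν : Fin P.d) :
    formComp (X ∘ projBond P jc j) ν = formComp X ν ∘ proj P jc j := rfl

/-- The forward covariant derivative is natural under `proj`. [cite: Balaban1985RegularSpaces, (1.1) p.76] -/
theorem covDerivFwdT_comp_proj (η : ℝ) (V : GaugeField P j 𝔸ˣ) (μ : Fin P.d) (G : Site P j → 𝔸) (x : Site (cover P jc) j) :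
    covDerivFwdT η (V ∘ projBond P jc j) μ (G ∘ proj P jc j) x = covDerivFwdT η V μ G (proj P jc j x) := by
  unfold T3SectALandauChart.covDerivFwdT
  simp only [Function.comp_apply, projBond, proj_shift]

/-- The covariant gradient of a one-form is natural under `proj`. [cite: Balaban1985Variational, (19) p.281] -/
theorem covGradT_comp_proj (η : ℝ) (V : GaugeField P j 𝔸ˣ) (X : PBond P j → 𝔸) (μ ν : Fin P.d) (x : Site (cover P jc) j) :
    covGradT η (V ∘ projBond P jc j) (X ∘ projBond P jc j) μ ν x = covGradT η V X μ ν (proj P jc j x) := by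
  unfold T3SectALandauChart.covGradT
  rw [formComp_comp_projBond, covDerivFwdT_comp_proj]

/-- The covariant curl of a one-form is natural under `proj`. [cite: Balaban1985BackgroundPropagators, (3.4) p.391] -/
theorem covCurlT_comp_proj (η : ℝ) (V : GaugeField P j 𝔸ˣ) (X : PBond P j → 𝔸) (μ ν : Fin P.d) (x : Site (cover P jc) j) :
    covCurlT η (V ∘ projBond P jc j) (X ∘ projBond P jc j) μ ν x = covCurlT η V X μ ν (proj P jc j x) := by
  unfold T3SectALandauChart.covCurlT
  rw [covGradT_comp_proj, covGradT_comp_proj]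

/-- The plaquette codifferential is natural under `proj`. [cite: Balaban1985BackgroundPropagators, (3.9) p.392] -/
theorem covCodiffT_comp_proj (η : ℝ) (V : GaugeField P j 𝔸ˣ) (Fp : Fin P.d → Fin P.d → Site P j → 𝔸) (μ : Fin P.d) (x : Site (cover P jc) j) :
    covCodiffT η (V ∘ projBond P jc j) (fun κ κ' => Fp κ κ' ∘ proj P jc j) μ x = covCodiffT η V Fp μ (proj P jc j x) := by
  unfold T3SectALandauChart.covCodiffT
  simp only [covDerivT_comp_proj]

/-- ★ `D^{η*}D^η` of a one-form (`covCodiffCurlT`, the letter of ✓`symm_DeltaEta_toL2_apply`) is natural under `proj`. [cite: Balaban1985BackgroundPropagators, (3.10) p.392] -/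
theorem covCodiffCurlT_comp_proj (η : ℝ) (V : GaugeField P j 𝔸ˣ) (X : PBond P j → 𝔸) (μ : Fin P.d) (x : Site (cover P jc) j) :
    covCodiffCurlT η (V ∘ projBond P jc j) (X ∘ projBond P jc j) μ x = covCodiffCurlT η V X μ (proj P jc j x) := by
  unfold T3SectALandauChart.covCodiffCurlT
  have h : covCurlT η (V ∘ projBond P jc j) (X ∘ projBond P jc j) = fun κ κ' => covCurlT η V X κ κ' ∘ proj P jc j := by
    funext κ κ' y; exact covCurlT_comp_proj P jc η V X κ κ' y
  rw [h, covCodiffT_comp_proj]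

/-- The covariant divergence of a one-form (`covDivFormT`) is natural under `proj`. [cite: Balaban1985BackgroundPropagators, (3.8) p.392] -/
theorem covDivFormT_comp_proj (η : ℝ) (V : GaugeField P j 𝔸ˣ) (X : PBond P j → 𝔸) (x : Site (cover P jc) j) :
    covDivFormT η (V ∘ projBond P jc j) (X ∘ projBond P jc j) x = covDivFormT η V X (proj P jc j x) := by
  unfold T3SectALandauChart.covDivFormT
  simp only [formComp_comp_projBond, covDerivT_comp_proj]

/-- The covariant Laplacian of a one-form component (`covLapFormT`) is natural under `proj`. [cite: Balaban1984PropagatorsI, (1.21) p.21] -/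
theorem covLapFormT_comp_proj (η : ℝ) (V : GaugeField P j 𝔸ˣ) (X : PBond P j → 𝔸) (ν : Fin P.d) (x : Site (cover P jc) j) :
    covLapFormT η (V ∘ projBond P jc j) (X ∘ projBond P jc j) ν x = covLapFormT η V X ν (proj P jc j x) := by
  unfold T3SectALandauChart.covLapFormT
  refine Finset.sum_congr rfl fun μ _ => ?_
  have h : covDerivFwdT η (V ∘ projBond P jc j) μ (formComp (X ∘ projBond P jc j) ν) = covDerivFwdT η V μ (formComp X ν) ∘ proj P jc j := by
    funext y; rw [formComp_comp_projBond]; exact covDerivFwdT_comp_proj P jc η V μ _ y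
  rw [h, covDerivT_comp_proj]

end TorusForms

end Summit.QuantumFields.YangMills.Theorems.Prop7CoverStencilNaturality

end
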